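/-
Copyright (c) 2026 the pub-hodgecm-mathlib formalisation cell (harness21).  Prover seat hodgecm-mathlib-K2Liu-p05 (g2), 2026-09-04
(Track B «K2-LIT», crux hLiu418 = stmt-HodgeConjecture-24832, organ (L24-a) of socket #24i∕#30i `sig_K2LiuThetaTypeSphericalEigenvalueInert`,
LEAD F0P6-plan (g11) RULING «M-155g» (ii)).
-/
import Summits.HodgeConjecture.HodgeConjecture.Theorems.K2LiuInertWeilSphericalLineOfRoots   -- ★ (this seat) §3–§4: the line from root data (ISO)
import Summits.HodgeConjecture.HodgeConjecture.Theorems.K2LiuLocalRingReImDictionary        -- ★ (this seat) §5: `re ∕ im ↔ 𝒪_w`, `Λ₀ = reIm(𝒪_{E_v}ᴺ)`, integral pairings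
import Literature.NumberTheory.Automorphic.GlobalAdditiveCharacterProofs                     -- ★ `Tate1950_adicComponent_adeleAddChar_holds` (`ψ_v` of conductor `𝒪_v` a.e.)
import HarnessLib

/-!
# (L24-a), the dock: root data (ISO) at a NON-SPLIT place from an INTEGRAL HYPERBOLIC FRAME of `E_vᴺ`, and the line
# `ω_v^K = ℂ · 1_{𝒪_vᴺ}` for every `K` containing the root elements of the frame

Topic: crux hLiu418 (stmt-HodgeConjecture-24832), Track B «K2-LIT», socket #24i∕#30i `sig_K2LiuThetaTypeSphericalEigenvalueInert`, organ (L24-a)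
(LEAD F0P6-plan (g11) RULING «M-155g» (ii)).  Sequel of ★ `Theorems/K2LiuInertWeilSphericalLine.lean` (engine run) and ★
`Theorems/K2LiuInertWeilSphericalLineOfRoots.lean` (expansion from root data (ISO)).  Namespace
`Summit.HodgeConjecture.HodgeConjecture.Cruxes.HLiu418.K2LiuInertWeilSphericalLine` (continued).  THEOREMS ONLY (no definition, no named fact, no instance,
no notation, no `sorry`); `--supports stmt-HodgeConjecture-24832 --as helper`; count-neutral.

THE MATHEMATICS.  `E_v = Π_{w ∣ v} E_w` (★ `LocalRing`), `z = ι_v(re z) + ι_v(im z) δ` (★ `quadraticLocalEquiv`), `σ = c ⊗ 1` (★ `conjLocal`),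
`h(x, y) = (σ x)ᵀ J_v y` (★ `hermForm`), `𝕎_v = F_vᴺ × F_vᴺ ≅ E_vᴺ` by `reIm`, `Λ₀ = 𝒪_vᴺ × 𝒪_vᴺ`.  §5 DICTIONARY (`v ∤ 2`, `δ` a unit above `v`): `z` is
integral at every `w ∣ v` iff `re z, im z ∈ 𝒪_v` (`z + σz = ι_v(2 re z)`, `z - σz = ι_v(2 im z) δ`; ★ `add_conjLocal`, `re∕im_conjLocal`, `valued_toPlace`,
`valued_galAdicCompletionMap`), with the strict version `z ∈ 𝔭_w ∀ w ⇒ re z, im z ∈ 𝔭_v`; so `Λ₀ = reIm(𝒪_{E_v}ᴺ)`, pairings of integral vectors are integral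
(`𝕋_v` integral) and `𝔫_y Λ₀ ⊆ Λ₀` for integral isotropic `y` (★ `localRootNil_reIm`).  §6 (ISO) FROM AN INTEGRAL HYPERBOLIC FRAME at a place with ONE
`w ∣ v`: integral isotropic `y, ys` with `x = h(ys, x) y + h(y, x) ys` for all `x` (a hyperbolic pair spanning `E_vᴺ`, `N = 2` in effect,
[Dieudonne1971GroupesClassiques, Chap. II §5]); for a PRIMITIVE box vector `u = reIm x` one of `h(ys, x)`, `h(y, x)` is a `w`-unit (else every
`x_j ∈ 𝔭_w` and `u ∈ 𝔭ᴺ × 𝔭ᴺ` by §5), and then `A(u, 𝔫_r u) = ι_v⁻¹(σ(α) α)`, `α = h(r, x)` (★ `alt_polar_localRootNil_self`, ★ `conjLocal_mul_self`) is a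
`v`-unit.  With the root elements of `y, ys` in `K` this is (ISO) of ★ `expansion_box_of_isotropicRoots`; HEADS: `(𝓢.omegaLoc v).fixedPoints K = ℂ ∙ 1_{𝒪_vᴺ}`
and the θ-factor line bound for every such `K` fixing `1_{𝒪_vᴺ}` — e.g. the hyperspecial `U(J)(𝒪_v)` at an inert good place with the frame `(T⁻¹e₀, T⁻¹e₁)` of
#28i∕#24i's `T ∈ GL₂(𝒪_w)` (★ K2Liu-p01 `hermForm_formCongr_frameVec`).

HONEST LABEL: HC_CM is proved only modulo the 7 printed citations (2 remaining named inputs: hLiu418 = stmt-HodgeConjecture-24832, h413 =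
stmt-HodgeConjecture-24833) until rung 0 closes; count-neutral helper toward #24i, closes nothing.

## References
* [MoeglinVignerasWaldspurger1987] C. Mœglin, M.-F. Vignéras, J.-L. Waldspurger, LNM 1291 (1987), Chap. 2 II.8, Chap. 5 I.4, I.11.
* [Howe1979] R. Howe, *θ-series and invariant theory*, Proc. Symp. Pure Math. 33.1 (1979), §2.
* [CasselsFrohlichANT1967] J. W. S. Cassels, A. Fröhlich (eds.), *Algebraic Number Theory* (1967), Ch. II §10 (`L ⊗_K K_v = Π L_w`), Ch. VII §1.1.
* [Dieudonne1971GroupesClassiques] J. Dieudonné, *La géométrie des groupes classiques* (1971), Chap. II §5.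
-/

set_option autoImplicit false
set_option linter.dupNamespace false

noncomputable section

open NumberField IsDedekindDomain
open scoped Matrix NNReal
open Literature.RepresentationTheory.HeisenbergGroup
open Literature.NumberTheory.Automorphic
open Literature.NumberTheory.Automorphic.UnitaryGroup
open Literature.NumberTheory.GelbartRogawski1991.UnitaryDualPair.LocalSplitting
open Literature.NumberTheory.GaloisRepresentations.IsNonarchimedeanLocalField

namespace Summit.HodgeConjecture.HodgeConjecture.Cruxes.HLiu418.K2LiuInertWeilSphericalLine

open Summit.HodgeConjecture.HodgeConjecture.Cruxes.HLiu418.K2LiuLocalRingReImDictionary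

/-! ## §6 (ISO) from an integral hyperbolic frame at a place with one `w ∣ v`, and the heads -/

section Frame

variable {F : Type} [Field F] [NumberField F] (E : Type) [Field E] [NumberField E] [Algebra F E]
  [Algebra.IsQuadraticExtension F E] (c : E ≃ₐ[F] E) (N : ℕ) {δ : E} (hcδ : c δ = -δ) (hδ : δ ≠ 0) {d : F}
  (hd : δ * δ = algebraMap F E d) (T : Matrix (Fin N) (Fin N) F) (hT : T.IsSymm)
  {J : Matrix (Fin N) (Fin N) E} (hJ : J = T.map (algebraMap F E)) (hJh : (J.map c)ᵀ = J)
  (v : HeightOneSpectrum (𝓞 F))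

include hJ in
/-- **the nilpotent of an integral isotropic vector preserves the self-dual box**: `𝔫_y Λ₀ ⊆ Λ₀` (`𝔫_y (reIm x) = reIm ((δ h(y, x)) • y)`, ★ `localRootNil_reIm`).
[cite: MoeglinVignerasWaldspurger1987, Ch. 1 I.17] -/
theorem localRootNil_mapsTo_box (h2 : Valued.v (2 : v.adicCompletion F) = 1)
    (hδu : ∀ w : PlacesOver E v, Valued.v (algebraMap E (LocalRing E v) δ w) = 1)
    (hTi : ∀ i j, localGram F N T v i j ∈ primePowBall (v.adicCompletion F) 0)
    {y : Fin N → LocalRing E v} (hy : ∀ (j : Fin N) (w : PlacesOver E v), y j w ∈ w.1.adicCompletionIntegers E) :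
    Set.MapsTo (localRootNil E c N J v hcδ hδ hd y)
      (piPrimePowBall (v.adicCompletion F) (Fin N) 0 ×ˢ piPrimePowBall (v.adicCompletion F) (Fin N) 0)
      (piPrimePowBall (v.adicCompletion F) (Fin N) 0 ×ˢ piPrimePowBall (v.adicCompletion F) (Fin N) 0) := by
  intro u hu
  obtain ⟨x, rfl⟩ := (QuadraticCoordinates.reIm (quadraticLocalEquiv E v c hcδ hδ).toLinearEquiv.toAddEquiv (Fin N)).surjective u
  have hx := forall_mem_integers_of_reIm_mem_box E c N hcδ hδ hd v hδu x hu
  rw [localRootNil_reIm]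
  refine reIm_mem_box_of_forall_mem_integers E c N hcδ hδ hd v h2 hδu _ fun j w => ?_
  rw [Pi.smul_apply, smul_eq_mul, Pi.mul_apply, Pi.mul_apply]
  refine mul_mem (mul_mem ?_ (hermForm_apply_mem_integers E c N T hJ v hTi hy hx w)) (hy j w)
  rw [HeightOneSpectrum.mem_adicCompletionIntegers]
  exact (hδu w).le

include hT hJ hJh in
/-- **a `w`-UNIT pairing gives a `v`-UNIT `A(u, 𝔫_r u)`**: if `h(r, x)` is a unit at the (unique) place `w₀ ∣ v`, then
`‖A(reIm x, 𝔫_r (reIm x))‖_v = 1` (`A(reIm x, 𝔫_r reIm x) = ι_v⁻¹(σ(α) α)`, `α = h(r, x)`: ★ `alt_polar_localRootNil_self`, ★ `conjLocal_mul_self`, ★ `valued_toPlace`).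
[cite: MoeglinVignerasWaldspurger1987, Chap. 1 I.11 (4 b)] -/
theorem normAbs_alt_localRootNil_eq_one_of_unit (w₀ : PlacesOver E v) (hw₀ : ∀ w : PlacesOver E v, w = w₀)
    (r x : Fin N → LocalRing E v)
    (hunit : Valued.v (hermForm (conjLocal E c v) ((adelicForm E N J).map (adeleToLocal E v)) r x w₀) = 1) :
    normAbs (v.adicCompletion F) (alt (polar (localPairing F N T v))
      (QuadraticCoordinates.reIm (quadraticLocalEquiv E v c hcδ hδ).toLinearEquiv.toAddEquiv (Fin N) x)
      (localRootNil E c N J v hcδ hδ hd r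
        (QuadraticCoordinates.reIm (quadraticLocalEquiv E v c hcδ hδ).toLinearEquiv.toAddEquiv (Fin N) x))) = 1 := by
  have he := ramificationIdx'_ne_zero_placesOver E v w₀
  rw [alt_polar_localRootNil_self E c N J v hcδ hδ hd T hT hJ hJh]
  generalize hα : hermForm (conjLocal E c v) ((adelicForm E N J).map (adeleToLocal E v)) r x = α at hunit
  generalize ht : QuadraticCoordinates.re (quadraticLocalEquiv E v c hcδ hδ).toLinearEquiv.toAddEquiv α ^ 2 -
      (d : v.adicCompletion F) * QuadraticCoordinates.im (quadraticLocalEquiv E v c hcδ hδ).toLinearEquiv.toAddEquiv α ^ 2 = t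
  have hkey : conjLocal E c v α * α = toLocalRing E v t := by rw [← ht]; exact conjLocal_mul_self E c hcδ hδ hd v α
  -- `|σ(α)_{w₀}| = 1`: `σ(α)_{w₀} = c_*(α_{c⁻¹ w₀})` and `c⁻¹ w₀ = w₀`
  have hall : ∀ p : PlacesOver E v, Valued.v (α p) = 1 := fun p => by rw [hw₀ p]; exact hunit
  have hσ : Valued.v (conjLocal E c v α w₀) = 1 := by
    have h := hall ⟨c⁻¹ • w₀.1, under_inv_smul_eq c w₀⟩
    rw [conjLocal_apply, valued_galAdicCompletionMap]
    exact h
  have hval : Valued.v t ^ v.asIdeal.ramificationIdx' w₀.1.asIdeal = 1 := by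
    rw [← valued_toPlace, ← toLocalRing_apply (E := E), ← hkey, Pi.mul_apply, map_mul, hσ, hunit, one_mul]
  replace hval : Valued.v t = 1 := (pow_eq_one_iff_of_nonneg zero_le he).1 hval
  refine le_antisymm ?_ ?_
  · rw [← map_one (normAbs (v.adicCompletion F)), normAbs_le_normAbs_iff_valued, hval, map_one]
  · rw [← map_one (normAbs (v.adicCompletion F)), normAbs_le_normAbs_iff_valued, hval, map_one]

include hT hJ in
/-- **(ISO) FROM AN INTEGRAL HYPERBOLIC FRAME.**  At a place `v` with ONE place `w₀` above it, `2` a `v`-unit, `δ` a `w₀`-unit, `𝕋_v` `v`-integral, let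
`y, ys ∈ E_vᴺ` be integral ISOTROPIC vectors with the frame identity `x = h(ys, x) • y + h(y, x) • ys` for all `x` (an integral
hyperbolic basis; `N = 2`), whose root elements `n_{bδ}(y)`, `n_{bδ}(ys)` (`b ∈ 𝒪_v`) lie in `K`.  Then `K` satisfies the root-data hypothesis (ISO) of
★ `expansion_box_of_isotropicRoots`: every primitive box vector `u ∈ Λ₀ ∖ (𝔭ᴺ × 𝔭ᴺ)` has `r ∈ {y, ys}` with `𝔫_r Λ₀ ⊆ Λ₀` and `‖A(u, 𝔫_r u)‖_v = 1`.
[cite: MoeglinVignerasWaldspurger1987, Chap. 5 I.4] [cite: Dieudonne1971GroupesClassiques, Chap. II §5] -/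
theorem iso_of_integralHyperbolicFrame (w₀ : PlacesOver E v) (hw₀ : ∀ w : PlacesOver E v, w = w₀)
    (h2 : Valued.v (2 : v.adicCompletion F) = 1)
    (hδu : ∀ w : PlacesOver E v, Valued.v (algebraMap E (LocalRing E v) δ w) = 1)
    (hTi : ∀ i j, localGram F N T v i j ∈ primePowBall (v.adicCompletion F) 0)
    (K : Subgroup (UnitaryGroup.localPi E c N J v)) {y ys : Fin N → LocalRing E v}
    (hy : hermForm (conjLocal E c v) ((adelicForm E N J).map (adeleToLocal E v)) y y = 0)
    (hys : hermForm (conjLocal E c v) ((adelicForm E N J).map (adeleToLocal E v)) ys ys = 0)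
    (hyi : ∀ (j : Fin N) (w : PlacesOver E v), y j w ∈ w.1.adicCompletionIntegers E)
    (hysi : ∀ (j : Fin N) (w : PlacesOver E v), ys j w ∈ w.1.adicCompletionIntegers E)
    (hframe : ∀ x : Fin N → LocalRing E v,
      x = hermForm (conjLocal E c v) ((adelicForm E N J).map (adeleToLocal E v)) ys x • y +
        hermForm (conjLocal E c v) ((adelicForm E N J).map (adeleToLocal E v)) y x • ys)
    (hKy : ∀ b ∈ v.adicCompletionIntegers F, localRootElt E c N J v hcδ hδ hJh hy b ∈ K)
    (hKys : ∀ b ∈ v.adicCompletionIntegers F, localRootElt E c N J v hcδ hδ hJh hys b ∈ K) :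
    ∀ u ∈ piPrimePowBall (v.adicCompletion F) (Fin N) 0 ×ˢ piPrimePowBall (v.adicCompletion F) (Fin N) 0,
      u ∉ piPrimePowBall (v.adicCompletion F) (Fin N) 1 ×ˢ piPrimePowBall (v.adicCompletion F) (Fin N) 1 →
      ∃ (r : Fin N → UnitaryGroup.LocalRing E v)
        (hr : hermForm (conjLocal E c v) ((adelicForm E N J).map (adeleToLocal E v)) r r = 0),
        (∀ b ∈ v.adicCompletionIntegers F, localRootElt E c N J v hcδ hδ hJh hr b ∈ K) ∧
        Set.MapsTo (localRootNil E c N J v hcδ hδ hd r)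
          (piPrimePowBall (v.adicCompletion F) (Fin N) 0 ×ˢ piPrimePowBall (v.adicCompletion F) (Fin N) 0)
          (piPrimePowBall (v.adicCompletion F) (Fin N) 0 ×ˢ piPrimePowBall (v.adicCompletion F) (Fin N) 0) ∧
        normAbs (v.adicCompletion F) (alt (polar (localPairing F N T v)) u (localRootNil E c N J v hcδ hδ hd r u)) = 1 := by
  intro u hu hu1
  obtain ⟨x, rfl⟩ := (QuadraticCoordinates.reIm (quadraticLocalEquiv E v c hcδ hδ).toLinearEquiv.toAddEquiv (Fin N)).surjective u
  have hx := forall_mem_integers_of_reIm_mem_box E c N hcδ hδ hd v hδu x hu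
  -- the two frame coordinates `a = h(ys, x)`, `b = h(y, x)` are integral and one of them is a `w₀`-unit
  have ha := hermForm_apply_mem_integers E c N T hJ v hTi hysi hx w₀
  have hb := hermForm_apply_mem_integers E c N T hJ v hTi hyi hx w₀
  rw [HeightOneSpectrum.mem_adicCompletionIntegers] at ha hb
  have hunit : Valued.v (hermForm (conjLocal E c v) ((adelicForm E N J).map (adeleToLocal E v)) ys x w₀) = 1 ∨
      Valued.v (hermForm (conjLocal E c v) ((adelicForm E N J).map (adeleToLocal E v)) y x w₀) = 1 := by
    by_contra hne
    push Not at hne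
    have ha' := lt_of_le_of_ne ha hne.1
    have hb' := lt_of_le_of_ne hb hne.2
    refine hu1 (reIm_mem_smallBox_of_forall_lt E c N hcδ hδ hd v h2 hδu x fun j w => ?_)
    rw [hw₀ w]
    have hxj : x j = hermForm (conjLocal E c v) ((adelicForm E N J).map (adeleToLocal E v)) ys x * y j +
        hermForm (conjLocal E c v) ((adelicForm E N J).map (adeleToLocal E v)) y x * ys j := by
      have h := congrFun (hframe x) j
      rw [Pi.add_apply, Pi.smul_apply, Pi.smul_apply, smul_eq_mul, smul_eq_mul] at h
      exact h
    rw [hxj, Pi.add_apply, Pi.mul_apply, Pi.mul_apply]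
    refine (Valuation.map_add _ _ _).trans_lt (max_lt ?_ ?_)
    · rw [map_mul]
      exact mul_lt_one_of_lt_of_le ha' ((HeightOneSpectrum.mem_adicCompletionIntegers _ _ _).1 (hyi j w₀))
    · rw [map_mul]
      exact mul_lt_one_of_lt_of_le hb' ((HeightOneSpectrum.mem_adicCompletionIntegers _ _ _).1 (hysi j w₀))
  rcases hunit with ha1 | hb1
  · exact ⟨ys, hys, hKys, localRootNil_mapsTo_box E c N hcδ hδ hd T hJ v h2 hδu hTi hysi,
      normAbs_alt_localRootNil_eq_one_of_unit E c N hcδ hδ hd T hT hJ hJh v w₀ hw₀ ys x ha1⟩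
  · exact ⟨y, hy, hKy, localRootNil_mapsTo_box E c N hcδ hδ hd T hJ v h2 hδu hTi hyi,
      normAbs_alt_localRootNil_eq_one_of_unit E c N hcδ hδ hd T hT hJ hJh v w₀ hw₀ y x hb1⟩

/-- **(L24-a) FROM AN INTEGRAL HYPERBOLIC FRAME — the line `ω_v^K = ℂ ∙ 1_{𝒪_vᴺ}`.**  At a place `v` with one place `w₀` above it (NON-SPLIT), `2` a `v`-unit, `δ` a
`w₀`-unit, `ψ_v` of conductor `𝒪_v`, `det T` a unit and `𝕋_v` `v`-integral, for an integral hyperbolic frame `(y, ys)` of `E_vᴺ` as in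
`iso_of_integralHyperbolicFrame` and every subgroup `K ≤ U(J)(F_v)` FIXING `1_{𝒪_vᴺ}` under `ω_v` and CONTAINING the root elements `n_{bδ}(y)`, `n_{bδ}(ys)`
(`b ∈ 𝒪_v`) — e.g. the hyperspecial `U(J)(𝒪_v)` at an inert good place — the `K`-fixed vectors of `ω_v` are exactly `ℂ ∙ 1_{𝒪_vᴺ}`.
[cite: MoeglinVignerasWaldspurger1987, Chap. 5 I.4, I.11] [cite: Howe1979, §2] -/
theorem fixedPoints_omegaLoc_eq_span_unitVec_of_frame (𝓢 : FinLocalSplittings F E c N hcδ hδ hd T hT hJ) (hTd : IsUnit T.det)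
    (w₀ : PlacesOver E v) (hw₀ : ∀ w : PlacesOver E v, w = w₀)
    (h2 : Valued.v (2 : v.adicCompletion F) = 1) (h2' : (⅟(2 : v.adicCompletion F) : v.adicCompletion F) ∈ v.adicCompletionIntegers F)
    (hδu : ∀ w : PlacesOver E v, Valued.v (algebraMap E (LocalRing E v) δ w) = 1)
    (hcond : (adeleAddCharAt F v).HasConductorExp 0)
    (hTi : ∀ i j, localGram F N T v i j ∈ primePowBall (v.adicCompletion F) 0)
    (K : Subgroup (UnitaryGroup.localPi E c N J v))
    (hKφ : ∀ k ∈ K, 𝓢.omegaLoc v k (unitVec F (Fin N) v) = unitVec F (Fin N) v) {y ys : Fin N → LocalRing E v}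
    (hy : hermForm (conjLocal E c v) ((adelicForm E N J).map (adeleToLocal E v)) y y = 0)
    (hys : hermForm (conjLocal E c v) ((adelicForm E N J).map (adeleToLocal E v)) ys ys = 0)
    (hyi : ∀ (j : Fin N) (w : PlacesOver E v), y j w ∈ w.1.adicCompletionIntegers E)
    (hysi : ∀ (j : Fin N) (w : PlacesOver E v), ys j w ∈ w.1.adicCompletionIntegers E)
    (hframe : ∀ x : Fin N → LocalRing E v,
      x = hermForm (conjLocal E c v) ((adelicForm E N J).map (adeleToLocal E v)) ys x • y +
        hermForm (conjLocal E c v) ((adelicForm E N J).map (adeleToLocal E v)) y x • ys)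
    (hKy : ∀ b ∈ v.adicCompletionIntegers F, localRootElt E c N J v hcδ hδ hJh hy b ∈ K)
    (hKys : ∀ b ∈ v.adicCompletionIntegers F, localRootElt E c N J v hcδ hδ hJh hys b ∈ K) :
    (𝓢.omegaLoc v).fixedPoints K = ℂ ∙ unitVec F (Fin N) v :=
  fixedPoints_omegaLoc_eq_span_unitVec_of_isotropicRoots 𝓢 v hTd hJh h2' hcond hTi K hKφ
    (iso_of_integralHyperbolicFrame E c N hcδ hδ hd T hT hJ hJh v w₀ hw₀ h2 hδu hTi K hy hys hyi hysi hframe hKy hKys)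

/-- **(L24-a) FOR THE LOCAL θ-FACTOR, FROM AN INTEGRAL HYPERBOLIC FRAME**: under the hypotheses of `fixedPoints_omegaLoc_eq_span_unitVec_of_frame` and for
`K` COMPACT, the `K`-fixed vectors of the `χ`-coinvariants `TwistedCoinv.rep χ (ω_v) _` (any commuting `ρW`, e.g. the centre `U(W)(F_v)` through ★
`localCenter`; any character `χ`) lie on the line `ℂ ∙ [1_{𝒪_vᴺ}]` — the form (L24-c) feeds, after ★ `fixedPoints_comp_le_span` along `localLineInl v`, to
★ `IsHyperspecialAt.heckeOperator_inclPlace_apply_eq_smul`. [cite: MoeglinVignerasWaldspurger1987, Chap. 3 §IV.4, Chap. 5 I.11] [cite: Liu2021, App. D Lem. D.1 (l. 5226–5233)] -/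
theorem fixedPoints_twistedCoinv_omegaLoc_le_span_of_frame (𝓢 : FinLocalSplittings F E c N hcδ hδ hd T hT hJ) (hTd : IsUnit T.det)
    (w₀ : PlacesOver E v) (hw₀ : ∀ w : PlacesOver E v, w = w₀)
    (h2 : Valued.v (2 : v.adicCompletion F) = 1) (h2' : (⅟(2 : v.adicCompletion F) : v.adicCompletion F) ∈ v.adicCompletionIntegers F)
    (hδu : ∀ w : PlacesOver E v, Valued.v (algebraMap E (LocalRing E v) δ w) = 1)
    (hcond : (adeleAddCharAt F v).HasConductorExp 0)
    (hTi : ∀ i j, localGram F N T v i j ∈ primePowBall (v.adicCompletion F) 0)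
    (K : Subgroup (UnitaryGroup.localPi E c N J v)) (hKc : IsCompact (K : Set (UnitaryGroup.localPi E c N J v)))
    (hKφ : ∀ k ∈ K, 𝓢.omegaLoc v k (unitVec F (Fin N) v) = unitVec F (Fin N) v) {y ys : Fin N → LocalRing E v}
    (hy : hermForm (conjLocal E c v) ((adelicForm E N J).map (adeleToLocal E v)) y y = 0)
    (hys : hermForm (conjLocal E c v) ((adelicForm E N J).map (adeleToLocal E v)) ys ys = 0)
    (hyi : ∀ (j : Fin N) (w : PlacesOver E v), y j w ∈ w.1.adicCompletionIntegers E)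
    (hysi : ∀ (j : Fin N) (w : PlacesOver E v), ys j w ∈ w.1.adicCompletionIntegers E)
    (hframe : ∀ x : Fin N → LocalRing E v,
      x = hermForm (conjLocal E c v) ((adelicForm E N J).map (adeleToLocal E v)) ys x • y +
        hermForm (conjLocal E c v) ((adelicForm E N J).map (adeleToLocal E v)) y x • ys)
    (hKy : ∀ b ∈ v.adicCompletionIntegers F, localRootElt E c N J v hcδ hδ hJh hy b ∈ K)
    (hKys : ∀ b ∈ v.adicCompletionIntegers F, localRootElt E c N J v hcδ hδ hJh hys b ∈ K)
    {H : Type*} [Group H] {ρW : Representation ℂ H (SchwartzBruhat (Fin N → v.adicCompletion F))} (χ : H →* ℂˣ)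
    (hc : ∀ (g : UnitaryGroup.localPi E c N J v) (h : H), Commute (𝓢.omegaLoc v g) (ρW h)) :
    (Literature.RepresentationTheory.TwistedCoinv.rep χ (𝓢.omegaLoc v) hc).fixedPoints K ≤
      ℂ ∙ Literature.RepresentationTheory.TwistedCoinv.mk ρW χ (unitVec F (Fin N) v) :=
  fixedPoints_twistedCoinv_le_span (𝓢.omegaLoc v) (𝓢.isSmooth_omegaLoc v) χ hc hKc
    (fixedPoints_omegaLoc_eq_span_unitVec_of_frame E c N hcδ hδ hd T hT hJ hJh v 𝓢 hTd w₀ hw₀ h2 h2' hδu hcond hTi K hKφ hy hys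
      hyi hysi hframe hKy hKys).le

end Frame

/-! ## §7 The cofinite side conditions (for the `∃ S₀` of #24i) -/

/-- **`ψ_v` has conductor `𝒪_v` for all but finitely many `v`** (★ `Tate1950_adicComponent_adeleAddChar_holds`; `(adeleAddChar F).adicComponent v` is
`adeleAddCharAt F v` by `rfl`) — the hypothesis `hcond` above, cofinitely; the hypothesis `hKφ` is ★ `FinLocalSplittings.unitVec_mem_fixedPoints` (Ω1),
cofinitely. [cite: Tate1950, Lemma 2.2.3] -/
theorem eventually_hasConductorExp_zero_adeleAddCharAt (F : Type) [Field F] [NumberField F] :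
    ∀ᶠ v : HeightOneSpectrum (𝓞 F) in Filter.cofinite, (adeleAddCharAt F v).HasConductorExp 0 :=
  (Tate1950_adicComponent_adeleAddChar_holds F).2

/-- **`2` is a `v`-unit for all but finitely many `v`** — the hypothesis `h2`, cofinitely. [cite: CasselsFrohlichANT1967, Ch. II §16] -/
theorem eventually_valued_two_eq_one' (F : Type) [Field F] [NumberField F] :
    ∀ᶠ v : HeightOneSpectrum (𝓞 F) in Filter.cofinite, Valued.v (2 : v.adicCompletion F) = 1 :=
  (UnitaryGroup.eventually_valued_algebraMap_eq_one (E := F) (two_ne_zero : (2 : F) ≠ 0)).mono fun v hv => by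
    rwa [map_ofNat] at hv

/-- **`δ` is a unit at every place above `v`, for all but finitely many `v`** — the hypothesis `hδu`, cofinitely (`δ ≠ 0` is a unit at almost every place
of `E`, ★ `eventually_valued_algebraMap_eq_one`, pushed down along `w ↦ w ∩ 𝓞_F`, ★ `eventually_forall_placesOver`). [cite: CasselsFrohlichANT1967, Ch. II §16] -/
theorem eventually_forall_valued_delta_eq_one {F : Type} [Field F] [NumberField F] (E : Type) [Field E] [NumberField E] [Algebra F E]
    {δ : E} (hδ : δ ≠ 0) :
    ∀ᶠ v : HeightOneSpectrum (𝓞 F) in Filter.cofinite, ∀ w : PlacesOver E v, Valued.v (algebraMap E (LocalRing E v) δ w) = 1 :=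
  (UnitaryGroup.eventually_forall_placesOver (F := F) E (UnitaryGroup.eventually_valued_algebraMap_eq_one E hδ)).mono fun _ hv w => hv w

/-- **`𝕋_v` is `v`-integral for all but finitely many `v`** — the hypothesis `hTi`, cofinitely. [cite: CasselsFrohlichANT1967, Ch. II §16] -/
theorem eventually_forall_localGram_mem {F : Type} [Field F] [NumberField F] {N : ℕ} (T : Matrix (Fin N) (Fin N) F) :
    ∀ᶠ v : HeightOneSpectrum (𝓞 F) in Filter.cofinite, ∀ i j, localGram F N T v i j ∈ primePowBall (v.adicCompletion F) 0 := by
  simp only [Filter.eventually_all]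
  intro i j
  refine (eventually_algebraMap_mem_adicCompletionIntegers F (T i j)).mono fun v hv => ?_
  rw [mem_primePowBall_zero_iff]
  exact hv

end Summit.HodgeConjecture.HodgeConjecture.Cruxes.HLiu418.K2LiuInertWeilSphericalLine

end
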